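import Mathlib
import HarnessLib

/-!
# The flower lemma (Håstad–Jukna–Pudlák)

S. Jukna, *Extremal Combinatorics — with applications in computer science* (1st ed., Springer 2001)
[Jukna2001], Chapter 7 "Sunflowers", §7.2.2 "Relaxed disjointness", Lemma 7.3 with the proof
printed there; original: J. Håstad, S. Jukna, P. Pudlák, *Top-down lower bounds for depth-three
circuits*, Comput. Complexity 5 (1995) 99–112 [HastadJuknaPudlak1995].

Printed definitions: a *blocking set* of a family is a set meeting all its members, and the
*blocking number* `τ(𝓕)` is the least size of a blocking set (`τ(𝓕) = 0` if `∅ ∈ 𝓕`); the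
*restriction* of `𝓕` onto `Y` is `𝓕_Y = {S - Y : S ∈ 𝓕, S ⊇ Y}`; a *flower with `k` petals and
core `Y`* is a family with `τ(𝓕_Y) ≥ k`, i.e. (for `k ≥ 1`) `Y ∉ 𝓕` and no set of at most `k - 1`
points meets every petal `S - Y`, `Y ⊆ S ∈ 𝓕`. We spell this out (no new definitions).

**Lemma 7.3.** Let `𝓕` be a family of sets each of cardinality `s`. If `|𝓕| > (k-1)^s` then `𝓕`
contains a flower with `k` petals.

* `flower_lemma` — Lemma 7.3, with the printed proof: induction on `s`; either `τ(𝓕) ≥ k` (a flower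
  with empty core) or some blocking set of size `k - 1` contains a point `x` lying in more than
  `(k-1)^{s-1}` members, and a flower of `𝓕_x = {S - {x} : x ∈ S ∈ 𝓕}` with core `Y` gives a
  flower of `𝓕` with core `Y ∪ {x}`. We also record `|Y| < s`.
-/

namespace Literature.Combinatorics.SetFamily

open Finset

variable {α : Type*} [DecidableEq α]

/-- The pigeonhole step of the printed proof: if a set `T` meets every member of `𝓕` and
`|T| · d < |𝓕|`, then some point of `T` lies in more than `d` members of `𝓕`.
[cite: Jukna2001, Ch. 7 §7.2.2, proof of Lemma 7.3 ("at least `|𝓕|/(k-1)` of the members must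
contain some point `x`"); HastadJuknaPudlak1995] -/
theorem exists_mem_lt_degree_of_blocking (𝓕 : Finset (Finset α)) (T : Finset α) (d : ℕ)
    (hT : ∀ S ∈ 𝓕, (T ∩ S).Nonempty) (hbig : T.card * d < 𝓕.card) :
    ∃ x ∈ T, d < (𝓕.filter fun S => x ∈ S).card := by
  by_contra! hno
  have hcover : 𝓕 ⊆ T.biUnion fun x => 𝓕.filter fun S => x ∈ S := by
    intro S hS
    obtain ⟨x, hx⟩ := hT S hS
    rw [mem_inter] at hx
    exact mem_biUnion.mpr ⟨x, hx.1, mem_filter.mpr ⟨hS, hx.2⟩⟩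
  have hle : 𝓕.card ≤ T.card * d :=
    calc 𝓕.card ≤ (T.biUnion fun x => 𝓕.filter fun S => x ∈ S).card := card_le_card hcover
      _ ≤ ∑ x ∈ T, (𝓕.filter fun S => x ∈ S).card := card_biUnion_le
      _ ≤ ∑ _x ∈ T, d := sum_le_sum hno
      _ = T.card * d := by rw [sum_const, smul_eq_mul]
  omega

/-- **Lemma 7.3** (the flower lemma; Håstad–Jukna–Pudlák 1995). Let `𝓕` be a family of sets
each of cardinality `s`. If `|𝓕| > (k-1)^s` then `𝓕` contains a flower with `k` petals: there is
a core `Y` (with `|Y| < s`, so `Y ∉ 𝓕` and all petals are non-empty) such that `τ(𝓕_Y) ≥ k`,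
i.e. for every set `T` of at most `k - 1` points some member `S ⊇ Y` of `𝓕` has its petal `S - Y`
disjoint from `T`. (Printed for `k ≥ 1`; with truncated subtraction the statement also holds,
trivially, for `k = 0`.) [cite: Jukna2001, Ch. 7 §7.2.2, Lemma 7.3 and its proof;
HastadJuknaPudlak1995] -/
theorem flower_lemma (s k : ℕ) (𝓕 : Finset (Finset α))
    (h𝓕 : ∀ S ∈ 𝓕, S.card = s) (hbig : (k - 1) ^ s < 𝓕.card) :
    ∃ Y : Finset α, Y.card < s ∧
      ∀ T : Finset α, T.card ≤ k - 1 → ∃ S ∈ 𝓕, Y ⊆ S ∧ Disjoint T (S \ Y) := by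
  induction s generalizing 𝓕 with
  | zero =>
    have : 𝓕.card ≤ 1 := card_le_one.mpr fun A hA B hB => by
      rw [card_eq_zero.mp (h𝓕 A hA), card_eq_zero.mp (h𝓕 B hB)]
    simp only [pow_zero] at hbig
    omega
  | succ s ih =>
    by_cases hτ : ∀ T : Finset α, T.card ≤ k - 1 → ∃ S ∈ 𝓕, Disjoint T S
    · -- `τ(𝓕) ≥ k`: `𝓕` itself is a flower with empty core
      refine ⟨∅, by simp, fun T hT => ?_⟩
      obtain ⟨S, hS, hTS⟩ := hτ T hT
      exact ⟨S, hS, empty_subset _, by rwa [sdiff_empty]⟩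
    · -- a blocking set `T` with `|T| ≤ k - 1` and a point `x ∈ T` of large degree
      push Not at hτ
      obtain ⟨T, hTcard, hT⟩ := hτ
      have hT' : ∀ S ∈ 𝓕, (T ∩ S).Nonempty := fun S hS =>
        not_disjoint_iff_nonempty_inter.mp (hT S hS)
      obtain ⟨x, -, hxdeg⟩ := exists_mem_lt_degree_of_blocking 𝓕 T ((k - 1) ^ s) hT'
        (lt_of_le_of_lt (Nat.mul_le_mul_right _ hTcard) (by rw [← pow_succ']; exact hbig))
      -- the family `𝓕_x = {S - {x} : x ∈ S ∈ 𝓕}` of `s`-sets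
      have hinj : Set.InjOn (fun A : Finset α => A.erase x)
          (𝓕.filter (fun A => x ∈ A) : Set (Finset α)) := by
        intro A hA A' hA' h
        simp only [coe_filter, Set.mem_setOf_eq] at hA hA'
        have h' : insert x (A.erase x) = insert x (A'.erase x) := by
          simp only at h
          rw [h]
        rwa [insert_erase hA.2, insert_erase hA'.2] at h'
      have hFxs : ∀ A' ∈ (𝓕.filter fun A => x ∈ A).image (fun A => A.erase x), A'.card = s := by
        intro A' hA'
        obtain ⟨A, hA, rfl⟩ := mem_image.mp hA'
        rw [mem_filter] at hA
        rw [card_erase_of_mem hA.2, h𝓕 A hA.1]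
        rfl
      obtain ⟨Y, hYcard, hY⟩ := ih _ hFxs (by rw [card_image_of_injOn hinj]; exact hxdeg)
      -- `x ∉ Y`: `Y` lies inside some member of `𝓕_x`
      have hxY : x ∉ Y := by
        obtain ⟨S', hS', hYS', -⟩ := hY ∅ (by simp)
        obtain ⟨A, -, rfl⟩ := mem_image.mp hS'
        exact fun hx => notMem_erase x A (hYS' hx)
      -- the core `Y ∪ {x}`
      refine ⟨insert x Y, by rw [card_insert_of_notMem hxY]; omega, fun T' hT' => ?_⟩
      obtain ⟨S', hS', hYS', hdisj⟩ := hY T' hT'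
      obtain ⟨A, hA, rfl⟩ := mem_image.mp hS'
      rw [mem_filter] at hA
      refine ⟨A, hA.1, insert_subset hA.2 (hYS'.trans (erase_subset x A)), ?_⟩
      rwa [← sdiff_singleton_eq_erase, _root_.sdiff_sdiff_left, sup_eq_union, singleton_union]
        at hdisj

/-- The flower lemma with the core condition `Y ∉ 𝓕` (the printed convention `τ(𝓕_Y) = 0` when
`∅ ∈ 𝓕_Y`) in place of `|Y| < s`. [cite: Jukna2001, Ch. 7 §7.2.2, Lemma 7.3 and the definitions
preceding it; HastadJuknaPudlak1995] -/
theorem flower_lemma' (s k : ℕ) (𝓕 : Finset (Finset α))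
    (h𝓕 : ∀ S ∈ 𝓕, S.card = s) (hbig : (k - 1) ^ s < 𝓕.card) :
    ∃ Y : Finset α, Y ∉ 𝓕 ∧
      ∀ T : Finset α, T.card ≤ k - 1 → ∃ S ∈ 𝓕, Y ⊆ S ∧ Disjoint T (S \ Y) := by
  obtain ⟨Y, hYcard, hY⟩ := flower_lemma s k 𝓕 h𝓕 hbig
  exact ⟨Y, fun hYF => by have := h𝓕 Y hYF; omega, hY⟩

end Literature.Combinatorics.SetFamily
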